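import Literature.Computability.AlgebraicComplexity.ChowPolarizationDefs
import Literature.Computability.AlgebraicComplexity.Polarization
import HarnessLib

/-!
# Chow reciprocity, brick A2: the polarisation `ι_{n→d}` — equivariance, array formula, inverse

Cell `val-lit`, PROGRAMME #6 (`chowReciprocity_holds`; architect's note
`HOME/bip/NOTE-p7g5-chowReciprocity-discharge-sizing.md`, skeleton `p7g5-ChowReciprocitySkeleton`),
brick **A2** on the objects of `ChowReciprocityDefs.lean` (index convention (form, variable) =
`Fin d × Fin N`; `polarize N n d F` = the coefficient of `t₀⋯t_{d-1}` in `F(formCoeff_n(Σ_kk t_kk ℓ_kk^n))`,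
`formSubst N d A` = substitution `a_l ↦ A a_l` of each form's coefficient vector, through which `GL_N`
acts by `A = g⁻¹`). This is the RECTANGULAR version (`d` forms, `N` variables, degree `n`) of the
square-case plethysm bridge `AC/ChowPlethysmBridge.lean` (`plethysmBridge`, `plethysmRestitution`),
with the same engine: the symmetric array `arrOf d F` of a form of degree `d`
(`Hyperdeterminant.lean`) and the multinomial theorem for `ℓ_kk^n`.

* §1 Row exponent matrices `rowExp J` (defined in `ChowPolarizationDefs.lean`) (`J : Fin d → DegIdx (Fin N) n` a word of exponents; row `kk`
  of the `d × N` matrix is `J kk`), `rowMultCoef J = ∏_kk multinomial(J kk)`, the coefficients of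
  `formPower` (`coeff_formPower`, multinomial theorem), form-permutations.
* §2 **Equivariance for ALL `F`** (A2.1 `polarize_coordRep`, no homogeneity hypothesis): each
  Veronese row map `F ↦ F(formCoeff_n(ℓ_kk^n))` is equivariant (`aeval_coeff_formPower_coordSubst`,
  checked on values with `aeval_formCoeff_coordSubst` and `MvPolynomial.funext`), hence so is the
  `t`-level substitution (`algHom_ext` on the coordinates `X_e`) and its `t₀⋯t_{d-1}`-coefficient.
* §3 **The array formula** (A2's engine, also the `ι`-side handle for the transpose identity A3):
  `polarize (∏_r X_{J r}) = Σ_{σ ∈ S_d} ∏_r v_{σ r}(J r)` (`polarize_prod_X_eq_sum_perm`; words of the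
  wrong length give `0`), hence for a form `F` of degree `d`
  `polarize F = Σ_J (arrOf d F J · d! · rowMultCoef J) · Y^{rowExp J}` (`polarize_eq_sum_monomial`,
  `coeff_rowExp_polarize`), and `polarize` only sees the degree-`d` component
  (`polarize_eq_zero_of_isHomogeneous`).
* §4 **The inverse** `depolarize` (`ChowPolarizationDefs.lean`; restitution, `Ξ(p) = Σ_J coeff_{rowExp J}(p)/(d!·rowMultCoef J) · ∏_kk X_{J kk}`):
  `depolarize_polarize` (`Ξ ∘ ι = id` on forms of degree `d` ⇒ A2.2 `eq_zero_of_polarize_eq_zero`),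
  `polarize_depolarize` (`ι ∘ Ξ = id` on form-symmetric polynomials of form degrees `(n,…,n)` ⇒ A2.3
  `exists_polarize_eq`), and the image of `ι` is form-symmetric of form degrees `(n,…,n)`.
* §5 **Highest-weight vectors** (A2.4 `mem_highestWeightSpace_of_polarize`, converse
  `formSubst_polarize_of_mem_highestWeightSpace`): `ι` reflects and preserves `B`-semi-invariance.

Characteristic zero is used for the divisions by `d!`, multinomial coefficients and fibre sizes, and
for `MvPolynomial.funext`. Honest framing: classical invariant theory (polarisation / restitution,
Landsberg GCT §9.1, Ex. 9.1.2.1) serving DIP 2020's toy separation; nothing here bears on VP ≠ VNP,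
which is NOT proved.

## References

* J. M. Landsberg, *Geometric Complexity Theory* (CUP 2017), §9.1.1–9.1.2, Ex. 9.1.2.1
  (`Sym^d(Sym^n V) ⊂ V^{⊗nd}`, `h_{d,n}ᵀ = h_{n,d}`). [Landsberg2017]
* P. Bürgisser, J. Hüttenhain, C. Ikenmeyer, *Permanent versus determinant: not via saturations*,
  Proc. AMS 145 (2017), §3 (polarisation at Veronese points, square case). [BurgisserHuttenhainIkenmeyer2017]
-/


noncomputable section

open MvPolynomial

namespace Literature.Computability.AlgebraicComplexity

namespace ChowReciprocity

open Literature.NumberTheory.DiophantineGeometry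

variable {k : Type} [Field k] {N n d : ℕ}

/-! ## §1 Row exponent matrices and the coefficients of `ℓ_kk^n` -/

/-- Unfolding of `rowExp`. [cite: Landsberg2017, Ex. 9.1.2.1] -/
@[simp]
theorem rowExp_apply (J : Fin d → DegIdx (Fin N) n) (li : Fin d × Fin N) :
    rowExp J li = (J li.1).1 li.2 := by
  simp [rowExp]

/-- `J ↦ M_J` is injective. [cite: Landsberg2017, Ex. 9.1.2.1] -/
theorem rowExp_injective : Function.Injective (rowExp (N := N) (n := n) (d := d)) := by
  intro J J' h
  funext kk
  apply Subtype.ext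
  ext i
  have := congrArg (fun s => s (kk, i)) h
  simpa using this

/-- The row sums of `M_J` are all `n`. [cite: Landsberg2017, Ex. 9.1.2.1] -/
theorem sum_rowExp_apply (J : Fin d → DegIdx (Fin N) n) (kk : Fin d) :
    ∑ i : Fin N, rowExp J (kk, i) = n := by
  simp only [rowExp_apply]
  rw [← Finsupp.degree_eq_sum]
  exact mem_degMonomials_iff.mp (J kk).2

/-- `∏_kk ∏_i Y_{(kk,i)}^{(J kk)_i}` is the monomial with exponent matrix `M_J`.
[cite: Landsberg2017, Ex. 9.1.2.1] -/
theorem prod_prod_X_pow_eq_monomial_rowExp (J : Fin d → DegIdx (Fin N) n) :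
    ∏ kk : Fin d, ∏ i : Fin N, (X (kk, i) : MvPolynomial (Fin d × Fin N) k) ^ ((J kk).1 i) =
      monomial (rowExp J) 1 := by
  rw [monomial_eq, C_1, one_mul, Finsupp.prod_fintype _ _ (fun v => pow_zero _),
    Fintype.prod_prod_type]
  simp only [rowExp_apply]

/-- `rowMultCoef J` is positive. [cite: Landsberg2017, Ex. 9.1.2.1] -/
theorem rowMultCoef_pos (J : Fin d → DegIdx (Fin N) n) : 0 < rowMultCoef J :=
  Finset.prod_pos fun kk _ => by
    rw [Finsupp.multinomial_eq]
    exact Nat.multinomial_pos _ _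

/-- `d! · rowMultCoef J ≠ 0` in characteristic zero. [cite: Landsberg2017, Ex. 9.1.2.1] -/
theorem factorial_mul_rowMultCoef_ne_zero [CharZero k] (J : Fin d → DegIdx (Fin N) n) :
    ((d.factorial : k) * rowMultCoef J) ≠ 0 :=
  mul_ne_zero (Nat.cast_ne_zero.mpr d.factorial_ne_zero)
    (Nat.cast_ne_zero.mpr (rowMultCoef_pos J).ne')

/-- `rowMultCoef` is invariant under permuting the rows. [cite: Landsberg2017, Ex. 9.1.2.1] -/
theorem rowMultCoef_comp_perm (J : Fin d → DegIdx (Fin N) n) (π : Equiv.Perm (Fin d)) :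
    rowMultCoef (J ∘ ⇑π) = rowMultCoef J :=
  Fintype.prod_equiv π _ _ fun _ => rfl

/-- **The coefficients of `ℓ_kk^n`** (multinomial theorem): the coefficient of `x^e` (`|e| = n`) in
`formPower N n d kk = (Σ_i Y_{(kk,i)} x_i)^n` is `multinomial(e) · ∏_i Y_{(kk,i)}^{e_i}` — the weighted
Veronese point. [cite: Landsberg2017, Ex. 9.1.2.1 (inclusion Sym^n V ⊂ V^{⊗n})] -/
theorem coeff_formPower (kk : Fin d) (e : DegIdx (Fin N) n) :
    coeff e.1 (formPower (k := k) N n d kk) =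
      ((e.1.multinomial : ℕ) : MvPolynomial (Fin d × Fin N) k) *
        ∏ i : Fin N, (X (kk, i) : MvPolynomial (Fin d × Fin N) k) ^ (e.1 i) := by
  have hform : (∑ i : Fin N, C (X (kk, i)) * X i :
      MvPolynomial (Fin N) (MvPolynomial (Fin d × Fin N) k)) =
      ∑ i : Fin N, (X (kk, i) : MvPolynomial (Fin d × Fin N) k) • X i := by
    simp only [smul_eq_C_mul]
  have hdeg : e.1.sum (fun _ m => m) = n := by
    have h := mem_degMonomials_iff.mp e.2
    rwa [Finsupp.degree_apply] at h
  unfold formPower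
  rw [hform, coeff_linearCombination_X_pow_of_fintype, if_pos hdeg]
  congr 1
  exact Finsupp.prod_fintype _ _ fun i => pow_zero _

/-- **The product over the rows of the Veronese coefficients of the letters of `J`** is
`rowMultCoef J · Y^{M_J}`. [cite: Landsberg2017, Ex. 9.1.2.1] -/
theorem prod_coeff_formPower (J : Fin d → DegIdx (Fin N) n) :
    ∏ kk : Fin d, coeff (J kk).1 (formPower (k := k) N n d kk) =
      monomial (rowExp J) (rowMultCoef J : k) := by
  simp_rw [coeff_formPower]
  rw [Finset.prod_mul_distrib, prod_prod_X_pow_eq_monomial_rowExp, rowMultCoef, Nat.cast_prod]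
  have h : (∏ x : Fin d, (((J x).1.multinomial : ℕ) : MvPolynomial (Fin d × Fin N) k)) =
      C (∏ x : Fin d, (((J x).1.multinomial : ℕ) : k)) := by
    rw [map_prod]
    exact Finset.prod_congr rfl fun r _ => (map_natCast C _).symm
  rw [h, C_mul_monomial, mul_one]

/-- Permuting the rows of `M_J` by `π` gives `M_{J ∘ π⁻¹}`. [cite: Landsberg2017, Ex. 9.1.2.1] -/
theorem mapDomain_rowPerm_rowExp (π : Equiv.Perm (Fin d)) (J : Fin d → DegIdx (Fin N) n) :
    Finsupp.mapDomain (fun li : Fin d × Fin N => (π li.1, li.2)) (rowExp J) = rowExp (J ∘ ⇑π.symm) := by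
  have hinj : Function.Injective (fun li : Fin d × Fin N => (π li.1, li.2)) := by
    intro a b h
    simp only [Prod.mk.injEq] at h
    exact Prod.ext (π.injective h.1) h.2
  ext v
  have hv : v = (fun li : Fin d × Fin N => (π li.1, li.2)) (π.symm v.1, v.2) := by simp
  rw [hv, Finsupp.mapDomain_apply hinj]
  simp

/-- For a FORM-SYMMETRIC `p`, the coefficient of `Y^{M_J}` only depends on `J` up to permuting the
letters. [cite: Landsberg2017, Ex. 9.1.2.1] -/
theorem coeff_rowExp_comp_perm {p : MvPolynomial (Fin d × Fin N) k}
    (hsymm : ∀ π : Equiv.Perm (Fin d), rename (fun li : Fin d × Fin N => (π li.1, li.2)) p = p)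
    (J : Fin d → DegIdx (Fin N) n) (π : Equiv.Perm (Fin d)) :
    coeff (rowExp (J ∘ ⇑π)) p = coeff (rowExp J) p := by
  have hinj : Function.Injective (fun li : Fin d × Fin N => (π.symm li.1, li.2)) := by
    intro a b h
    simp only [Prod.mk.injEq] at h
    exact Prod.ext (π.symm.injective h.1) h.2
  have h := mapDomain_rowPerm_rowExp π.symm J
  rw [Equiv.symm_symm] at h
  rw [← h]
  conv_lhs => rw [← hsymm π.symm]
  exact coeff_rename_mapDomain _ hinj _ _

/-! ## §2 Equivariance (A2.1): `polarize (g · F) = formSubst g⁻¹ (polarize F)` for all `F` -/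

section Equivariance

omit [Field k] in
/-- Unfolding of `polarize`: the `t₀⋯t_{d-1}`-coefficient of `F(Σ_kk t_kk · formCoeff_n(ℓ_kk^n))`.
[cite: Landsberg2017, Ex. 9.1.2.1] -/
theorem polarize_apply [Field k] (F : MvPolynomial (DegIdx (Fin N) n) k) :
    polarize N n d F = coeff (∑ kk : Fin d, Finsupp.single kk 1)
      (aeval (fun e : DegIdx (Fin N) n => ∑ kk : Fin d,
        (X kk : MvPolynomial (Fin d) (MvPolynomial (Fin d × Fin N) k)) *
          C (coeff e.1 (formPower N n d kk))) F) :=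
  rfl

/-- The value of `formSubst A p` at a numerical tuple of forms `w`: `p` at `l ↦ A (w l)`.
[cite: Landsberg2017, §9.1.1 (equivariance)] -/
theorem eval_formSubst_eq (A : Matrix (Fin N) (Fin N) k) (w : Fin d × Fin N → k)
    (p : MvPolynomial (Fin d × Fin N) k) :
    eval w (formSubst N d A p) = eval (fun li : Fin d × Fin N => ∑ i' : Fin N, A li.2 i' * w (li.1, i')) p := by
  unfold formSubst
  change aeval w (aeval _ p) = aeval _ p
  have hfg : (fun li : Fin d × Fin N => aeval w (∑ i' : Fin N, A li.2 i' • (X (li.1, i') :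
      MvPolynomial (Fin d × Fin N) k))) = fun li => ∑ i' : Fin N, A li.2 i' * w (li.1, i') := by
    funext li
    simp only [map_sum, map_smul, aeval_X, smul_eq_mul]
  rw [← AlgHom.comp_apply, comp_aeval, hfg]

/-- A linear substitution `B` sends the linear form with coefficient vector `c` to the one with
coefficient vector `B c`. [folklore] -/
private theorem linSubst_linearForm' (B : Matrix (Fin N) (Fin N) k) (c : Fin N → k) :
    linSubst (Fin N) k B (linearForm c) = linearForm fun j => ∑ i, B j i * c i := by
  simp only [linearForm, map_sum, map_mul, linSubst_C, linSubst_X, Finset.mul_sum, smul_eq_C_mul]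
  rw [Finset.sum_comm]
  refine Finset.sum_congr rfl fun j _ => ?_
  rw [Finset.sum_mul]
  exact Finset.sum_congr rfl fun i _ => by ring

/-- **The Veronese row map is an evaluation**: the value at `w` of `F(formCoeff_n(ℓ_kk^n))` (generic
`ℓ_kk`) is `F` at the coefficient vector of `ℓ_{w_kk}^n`, `ℓ_{w_kk} = Σ_i w_{(kk,i)} x_i`.
[cite: Landsberg2017, Ex. 9.1.2.1] -/
theorem eval_aeval_coeff_formPower (kk : Fin d) (w : Fin d × Fin N → k)
    (F : MvPolynomial (DegIdx (Fin N) n) k) :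
    eval w (aeval (fun e : DegIdx (Fin N) n => coeff e.1 (formPower N n d kk)) F) =
      aeval (formCoeff n (linearForm (fun i => w (kk, i)) ^ n)) F := by
  change aeval w (aeval _ F) = _
  have hfg : (fun e : DegIdx (Fin N) n => aeval w (coeff e.1 (formPower (k := k) N n d kk))) =
      formCoeff n (linearForm (fun i => w (kk, i)) ^ n) := by
    funext e
    change eval w (coeff e.1 (formPower N n d kk)) = coeff e.1 _
    rw [← coeff_map, formPower, map_pow, map_sum]
    simp only [map_mul, map_C, map_X, eval_X, linearForm]
  rw [← AlgHom.comp_apply, comp_aeval, hfg]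

/-- **Each Veronese row map is `GL_N`-equivariant**: `(g·F)(ℓ_kk^n) = formSubst g⁻¹ (F(ℓ_kk^n))`
(`(g·F)(v) = F(g⁻¹ v)` and `(g⁻¹ ℓ)^n = g⁻¹ (ℓ^n)`; checked on values, `k` infinite).
[cite: Landsberg2017, §9.1.1 (equivariance)] -/
theorem aeval_coeff_formPower_coordSubst [CharZero k] (kk : Fin d) (g : GL (Fin N) k)
    (F : MvPolynomial (DegIdx (Fin N) n) k) :
    aeval (fun e : DegIdx (Fin N) n => coeff e.1 (formPower N n d kk)) (coordSubst n g F) =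
      formSubst N d ((g⁻¹ : GL (Fin N) k) : Matrix (Fin N) (Fin N) k)
        (aeval (fun e : DegIdx (Fin N) n => coeff e.1 (formPower N n d kk)) F) := by
  apply MvPolynomial.funext
  intro w
  rw [eval_aeval_coeff_formPower, aeval_formCoeff_coordSubst, linSubstRep_apply, map_pow,
    linSubst_linearForm', eval_formSubst_eq, eval_aeval_coeff_formPower]

/-- The `t`-level substitution `X_e ↦ Σ_kk t_kk · coeff_e(ℓ_kk^n)` intertwines `coordSubst g` with
`formSubst g⁻¹` applied to the `k[Mat_{d×N}]`-coefficients (checked on the coordinates `X_e` by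
`aeval_coeff_formPower_coordSubst`). [cite: Landsberg2017, §9.1.1–9.1.2 (equivariance)] -/
theorem aeval_tLevel_coordSubst [CharZero k] (g : GL (Fin N) k) (F : MvPolynomial (DegIdx (Fin N) n) k) :
    aeval (fun e : DegIdx (Fin N) n => ∑ kk : Fin d,
        (X kk : MvPolynomial (Fin d) (MvPolynomial (Fin d × Fin N) k)) *
          C (coeff e.1 (formPower N n d kk))) (coordSubst n g F) =
      map (formSubst N d ((g⁻¹ : GL (Fin N) k) : Matrix (Fin N) (Fin N) k) :
          MvPolynomial (Fin d × Fin N) k →+* MvPolynomial (Fin d × Fin N) k)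
        (aeval (fun e : DegIdx (Fin N) n => ∑ kk : Fin d,
          (X kk : MvPolynomial (Fin d) (MvPolynomial (Fin d × Fin N) k)) *
            C (coeff e.1 (formPower N n d kk))) F) := by
  classical
  -- as an identity of `k`-algebra maps, checked on the coordinates `X_e`
  suffices hcomp :
      (aeval (fun e : DegIdx (Fin N) n => ∑ kk : Fin d,
          (X kk : MvPolynomial (Fin d) (MvPolynomial (Fin d × Fin N) k)) *
            C (coeff e.1 (formPower N n d kk)))).comp (coordSubst n g) =
        (mapAlgHom (formSubst N d ((g⁻¹ : GL (Fin N) k) : Matrix (Fin N) (Fin N) k))).comp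
          (aeval (fun e : DegIdx (Fin N) n => ∑ kk : Fin d,
            (X kk : MvPolynomial (Fin d) (MvPolynomial (Fin d × Fin N) k)) *
              C (coeff e.1 (formPower N n d kk)))) by
    have happ := congrArg (fun ψ => ψ F) hcomp
    simpa only [AlgHom.comp_apply, mapAlgHom_apply] using happ
  apply MvPolynomial.algHom_ext
  intro e
  -- per row: `formSubst g⁻¹ (v_kk e) = Σ_x c_{e x} • v_kk x`
  have hrow : ∀ kk : Fin d,
      formSubst N d ((g⁻¹ : GL (Fin N) k) : Matrix (Fin N) (Fin N) k) (coeff e.1 (formPower N n d kk)) =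
        ∑ x : DegIdx (Fin N) n, coeff e.1 (linSubstRep (Fin N) k g⁻¹ (monomial x.1 1)) •
          coeff x.1 (formPower N n d kk) := by
    intro kk
    have h := aeval_coeff_formPower_coordSubst (d := d) kk g (X e : MvPolynomial (DegIdx (Fin N) n) k)
    rw [aeval_X, coordSubst_X, map_sum] at h
    simp only [map_smul, aeval_X] at h
    exact h.symm
  rw [AlgHom.comp_apply, AlgHom.comp_apply, mapAlgHom_apply, aeval_X, coordSubst_X, map_sum]
  simp only [map_smul, aeval_X, Finset.smul_sum]
  rw [Finset.sum_comm, map_sum]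
  refine Finset.sum_congr rfl fun kk _ => ?_
  rw [map_mul, map_X, map_C, RingHom.coe_coe, hrow, map_sum, Finset.mul_sum]
  refine Finset.sum_congr rfl fun x _ => ?_
  rw [Algebra.smul_def, Algebra.smul_def, MvPolynomial.algebraMap_apply, map_mul]
  simp only [MvPolynomial.algebraMap_eq]
  ring

/-- **A2.1 — equivariance of the polarisation**: `polarize (g · F) = formSubst g⁻¹ (polarize F)` for
EVERY `F` (the `t`-level substitution intertwines `coordSubst g` with `formSubst g⁻¹` on coefficients,
by `aeval_coeff_formPower_coordSubst` on the coordinates `X_e`; then take the `t₀⋯t_{d-1}`-coefficient).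
[cite: Landsberg2017, §9.1.1–9.1.2 (equivariance of h_{d,n} and of Sym^d(Sym^n V) ⊂ V^{⊗nd})] -/
theorem polarize_coordRep [CharZero k] (g : GL (Fin N) k) (F : MvPolynomial (DegIdx (Fin N) n) k) :
    polarize N n d (coordRep (Fin N) k n g F) =
      formSubst N d ((g⁻¹ : GL (Fin N) k) : Matrix (Fin N) (Fin N) k) (polarize N n d F) := by
  classical
  rw [polarize_apply, polarize_apply, coordRep_apply, aeval_tLevel_coordSubst]
  exact coeff_map _ _ _

end Equivariance

/-! ## §3 The array formula -/

section ArrayFormula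

/-- The monomial of a word is the product of its letters (any commutative coefficient ring; the
tree's `prod_X_eq_monomial_wordExp` is stated over a field). [folklore] -/
private theorem prod_X_eq_monomial_wordExp' {R : Type*} [CommSemiring R] {σ : Type*} {ℓ : ℕ}
    (J : Fin ℓ → σ) : (∏ j, X (J j) : MvPolynomial σ R) = monomial (wordExp J) 1 := by
  rw [wordExp, monomial_sum_index, C_1, one_mul]
  rfl

/-- **`polarize` on a product of letters** `X_{J 0} ⋯ X_{J (j-1)}` (a word of ANY length `j`): the sum,
over the maps `ψ : Fin j → Fin d` whose content is `t₀⋯t_{d-1}` (i.e. the bijections), of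
`∏_r v_{ψ r}(J r)`, `v_kk(e) = coeff_e(ℓ_kk^n)`. [cite: Landsberg2017, Ex. 9.1.2.1] -/
theorem polarize_prod_X_eq_sum_ite {j : ℕ} (J : Fin j → DegIdx (Fin N) n) :
    polarize N n d (∏ r : Fin j, X (J r)) =
      ∑ ψ : Fin j → Fin d, if wordExp ψ = ∑ kk : Fin d, Finsupp.single kk 1 then
        ∏ r : Fin j, coeff (J r).1 (formPower (k := k) N n d (ψ r)) else 0 := by
  classical
  rw [polarize_apply, map_prod]
  simp only [aeval_X]
  rw [Finset.prod_univ_sum]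
  simp only [Fintype.piFinset_univ]
  rw [coeff_sum]
  refine Finset.sum_congr rfl fun ψ _ => ?_
  rw [Finset.prod_mul_distrib, prod_X_eq_monomial_wordExp', ← map_prod, mul_comm, C_mul_monomial,
    mul_one, coeff_monomial]

/-- The `t`-content `t₀⋯t_{d-1}` is the content of the identity word. [folklore] -/
private theorem sum_single_eq_wordExp_id :
    (∑ kk : Fin d, Finsupp.single kk 1 : Fin d →₀ ℕ) = wordExp (id : Fin d → Fin d) :=
  rfl

/-- Words of length `j ≠ d` never have content `t₀⋯t_{d-1}`: `polarize` KILLS products of `j ≠ d`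
letters. [cite: Landsberg2017, Ex. 9.1.2.1] -/
theorem polarize_prod_X_of_ne {j : ℕ} (hj : j ≠ d) (J : Fin j → DegIdx (Fin N) n) :
    polarize N n d (∏ r : Fin j, X (J r) : MvPolynomial (DegIdx (Fin N) n) k) = 0 := by
  rw [polarize_prod_X_eq_sum_ite]
  refine Finset.sum_eq_zero fun ψ _ => ?_
  rw [if_neg]
  intro h
  apply hj
  have h1 := congrArg Finsupp.degree h
  rw [degree_wordExp, sum_single_eq_wordExp_id, degree_wordExp] at h1
  exact h1

/-- **`polarize` on a product of `d` letters** is the sum over the PERMUTATIONS `σ ∈ S_d` of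
`∏_r v_{σ r}(J r)` (full polarisation). [cite: Landsberg2017, Ex. 9.1.2.1] -/
theorem polarize_prod_X_eq_sum_perm (J : Fin d → DegIdx (Fin N) n) :
    polarize N n d (∏ r : Fin d, X (J r)) =
      ∑ σ : Equiv.Perm (Fin d), ∏ r : Fin d, coeff (J r).1 (formPower (k := k) N n d (σ r)) := by
  classical
  rw [polarize_prod_X_eq_sum_ite, ← Finset.sum_filter]
  have hset : (Finset.univ.filter fun ψ : Fin d → Fin d =>
      wordExp ψ = ∑ kk : Fin d, Finsupp.single kk 1) =
      Finset.univ.map ⟨fun σ : Equiv.Perm (Fin d) => (σ : Fin d → Fin d), Equiv.coe_fn_injective⟩ := by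
    ext ψ
    simp only [Finset.mem_filter, Finset.mem_univ, true_and, Finset.mem_map,
      Function.Embedding.coeFn_mk]
    rw [sum_single_eq_wordExp_id]
    constructor
    · intro h
      obtain ⟨π, hπ⟩ := exists_comp_perm_eq_of_wordExp_eq h
      refine ⟨π.symm, ?_⟩
      funext x
      have h1 : ψ (π (π.symm x)) = π.symm x := congrFun hπ (π.symm x)
      rw [Equiv.apply_symm_apply] at h1
      exact h1.symm
    · rintro ⟨σ, rfl⟩
      exact wordExp_comp_perm id σ
  rw [hset, Finset.sum_map]
  rfl

/-- The product over `r` of `v_{σ r}(J r)` is the row product of the word `J ∘ σ⁻¹`: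
`rowMultCoef (J ∘ σ⁻¹) · Y^{M_{J ∘ σ⁻¹}}`. [cite: Landsberg2017, Ex. 9.1.2.1] -/
theorem prod_coeff_formPower_perm (J : Fin d → DegIdx (Fin N) n) (σ : Equiv.Perm (Fin d)) :
    ∏ r : Fin d, coeff (J r).1 (formPower (k := k) N n d (σ r)) =
      monomial (rowExp (J ∘ ⇑σ.symm)) (rowMultCoef (J ∘ ⇑σ.symm) : k) := by
  rw [← prod_coeff_formPower]
  exact Fintype.prod_equiv σ _ _ fun r => by simp

/-- **The array formula for the polarisation of a form of degree `d`** (characteristic zero):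
`polarize F = Σ_J (arrOf d F J · (d! · rowMultCoef J)) · Y^{M_J}` — diagonal in the monomial bases,
the full polarisation of `F` (its symmetric array `arrOf d F`, `Hyperdeterminant.lean`) evaluated at
the weighted Veronese rows. [cite: Landsberg2017, Ex. 9.1.2.1] -/
theorem polarize_eq_sum_monomial [CharZero k] {F : MvPolynomial (DegIdx (Fin N) n) k}
    (hF : F.IsHomogeneous d) :
    polarize N n d F = ∑ J : Fin d → DegIdx (Fin N) n,
      monomial (rowExp J) (arrOf d F J * ((d.factorial : k) * rowMultCoef J)) := by
  classical
  conv_lhs => rw [← sum_arrOf_mul_prod_X hF]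
  rw [map_sum]
  have hterm : ∀ J : Fin d → DegIdx (Fin N) n,
      polarize N n d (C (arrOf d F J) * ∏ r : Fin d, X (J r)) =
        ∑ σ : Equiv.Perm (Fin d), monomial (rowExp (J ∘ ⇑σ.symm))
          (arrOf d F (J ∘ ⇑σ.symm) * (rowMultCoef (J ∘ ⇑σ.symm) : k)) := by
    intro J
    rw [← smul_eq_C_mul, map_smul, polarize_prod_X_eq_sum_perm, Finset.smul_sum]
    refine Finset.sum_congr rfl fun σ _ => ?_
    rw [prod_coeff_formPower_perm, smul_monomial, smul_eq_mul, arrOf_comp_perm]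
  simp_rw [hterm]
  rw [Finset.sum_comm]
  -- for each `σ`, reindex `J ↦ J ∘ σ⁻¹`
  have hσ : ∀ σ : Equiv.Perm (Fin d),
      ∑ J : Fin d → DegIdx (Fin N) n, monomial (rowExp (J ∘ ⇑σ.symm))
          (arrOf d F (J ∘ ⇑σ.symm) * (rowMultCoef (J ∘ ⇑σ.symm) : k)) =
        ∑ J : Fin d → DegIdx (Fin N) n, monomial (rowExp J) (arrOf d F J * (rowMultCoef J : k)) := by
    intro σ
    exact Fintype.sum_equiv (Equiv.arrowCongr σ (Equiv.refl (DegIdx (Fin N) n))) _ _ fun J => by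
      have hJ : (Equiv.arrowCongr σ (Equiv.refl (DegIdx (Fin N) n))) J = J ∘ ⇑σ.symm := by
        funext r
        simp [Equiv.arrowCongr_apply]
      rw [hJ]
  simp_rw [hσ]
  rw [Finset.sum_const, Finset.card_univ, Fintype.card_perm, Fintype.card_fin, ← Finset.sum_nsmul]
  refine Finset.sum_congr rfl fun J _ => ?_
  rw [nsmul_eq_mul, ← C_eq_coe_nat, C_mul_monomial]
  congr 1
  ring

/-- **The coefficient of `Y^{M_J}` in `polarize F`** is `arrOf d F J · d! · rowMultCoef J`
(`F` a form of degree `d`, characteristic zero). [cite: Landsberg2017, Ex. 9.1.2.1] -/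
theorem coeff_rowExp_polarize [CharZero k] {F : MvPolynomial (DegIdx (Fin N) n) k}
    (hF : F.IsHomogeneous d) (J : Fin d → DegIdx (Fin N) n) :
    coeff (rowExp J) (polarize N n d F) = arrOf d F J * ((d.factorial : k) * rowMultCoef J) := by
  classical
  rw [polarize_eq_sum_monomial hF, coeff_sum, Finset.sum_eq_single J]
  · rw [coeff_monomial, if_pos rfl]
  · intro J' _ hJ'
    rw [coeff_monomial, if_neg fun h => hJ' (rowExp_injective h)]
  · intro h
    exact absurd (Finset.mem_univ J) h

/-- **`polarize` kills forms of degree `j ≠ d`** (it only sees the degree-`d` component).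
[cite: Landsberg2017, Ex. 9.1.2.1] -/
theorem polarize_eq_zero_of_isHomogeneous [CharZero k] {j : ℕ} (hj : j ≠ d)
    {F : MvPolynomial (DegIdx (Fin N) n) k} (hF : F.IsHomogeneous j) : polarize N n d F = 0 := by
  rw [← sum_arrOf_mul_prod_X hF, map_sum]
  refine Finset.sum_eq_zero fun J _ => ?_
  rw [← smul_eq_C_mul, map_smul, polarize_prod_X_of_ne hj, smul_zero]

end ArrayFormula

/-! ## §4 The restitution `depolarize` and the two compositions -/

section Restitution

/-- `Ξ(p)` is a form of degree `d`. [cite: Landsberg2017, Ex. 9.1.2.1] -/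
theorem isHomogeneous_depolarize (p : MvPolynomial (Fin d × Fin N) k) :
    (depolarize N n d p).IsHomogeneous d := by
  refine IsHomogeneous.sum _ _ _ fun J _ => ?_
  rw [prod_X_eq_monomial_wordExp, C_mul_monomial, mul_one]
  exact isHomogeneous_monomial _ (degree_wordExp J)

/-- `Ξ(0) = 0`. [cite: Landsberg2017, Ex. 9.1.2.1] -/
theorem depolarize_zero : depolarize (k := k) N n d 0 = 0 := by
  unfold depolarize
  simp

/-- **`Ξ ∘ ι = id` on forms of degree `d`** (characteristic zero): a form is the symmetrisation of its
array (`sum_arrOf_mul_prod_X`). [cite: Landsberg2017, Ex. 9.1.2.1] -/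
theorem depolarize_polarize [CharZero k] {F : MvPolynomial (DegIdx (Fin N) n) k}
    (hF : F.IsHomogeneous d) : depolarize N n d (polarize N n d F) = F := by
  unfold depolarize
  simp_rw [coeff_rowExp_polarize hF, mul_div_cancel_right₀ _ (factorial_mul_rowMultCoef_ne_zero (k := k) _)]
  exact sum_arrOf_mul_prod_X hF

/-- **A2.2 — `polarize` is injective on forms of degree `d`** (characteristic zero).
[cite: Landsberg2017, Ex. 9.1.2.1] -/
theorem eq_zero_of_polarize_eq_zero [CharZero k] {F : MvPolynomial (DegIdx (Fin N) n) k}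
    (hF : F.IsHomogeneous d) (h0 : polarize N n d F = 0) : F = 0 := by
  rw [← depolarize_polarize hF, h0, depolarize_zero]

/-- Forms of degree `d` with the same polarisation are equal. [cite: Landsberg2017, Ex. 9.1.2.1] -/
theorem polarize_injOn [CharZero k] {F G : MvPolynomial (DegIdx (Fin N) n) k}
    (hF : F.IsHomogeneous d) (hG : G.IsHomogeneous d) (h : polarize N n d F = polarize N n d G) :
    F = G := by
  rw [← depolarize_polarize hF, h, depolarize_polarize hG]

/-- The array of `Ξ(p)` for a form-symmetric `p`: `A(Ξ p)_J = coeff_{M_J}(p) / (d! · rowMultCoef J)`.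
[cite: Landsberg2017, Ex. 9.1.2.1] -/
theorem arrOf_depolarize [CharZero k] {p : MvPolynomial (Fin d × Fin N) k}
    (hsymm : ∀ π : Equiv.Perm (Fin d), rename (fun li : Fin d × Fin N => (π li.1, li.2)) p = p)
    (J : Fin d → DegIdx (Fin N) n) :
    arrOf d (depolarize N n d p) J = coeff (rowExp J) p / ((d.factorial : k) * rowMultCoef J) := by
  unfold depolarize
  rw [arrOf_sum_C_mul_prod_X]
  intro I π
  rw [coeff_rowExp_comp_perm hsymm, rowMultCoef_comp_perm]

/-- The rows of an exponent matrix with all row sums `n` form a word `J` with `M_J` the matrix.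
[cite: Landsberg2017, Ex. 9.1.2.1] -/
theorem exists_rowExp_eq {s : Fin d × Fin N →₀ ℕ} (hs : ∀ kk : Fin d, ∑ i : Fin N, s (kk, i) = n) :
    ∃ J : Fin d → DegIdx (Fin N) n, rowExp J = s := by
  refine ⟨fun kk => ⟨Finsupp.equivFunOnFinite.symm fun i => s (kk, i), mem_degMonomials_iff.mpr ?_⟩, ?_⟩
  · rw [Finsupp.degree_eq_sum]
    simp only [Finsupp.coe_equivFunOnFinite_symm]
    exact hs kk
  · ext v
    simp

/-- **A polynomial all of whose monomials have form degrees `(n,…,n)` is the sum of its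
`Y^{M_J}`-terms.** [cite: Landsberg2017, Ex. 9.1.2.1] -/
theorem sum_monomial_rowExp_coeff {p : MvPolynomial (Fin d × Fin N) k}
    (hdeg : ∀ a ∈ p.support, ∀ kk : Fin d, ∑ i : Fin N, a (kk, i) = n) :
    ∑ J : Fin d → DegIdx (Fin N) n, monomial (rowExp J) (coeff (rowExp J) p) = p := by
  classical
  rw [← Finset.sum_image (f := fun s => monomial s (coeff s p))
    (fun J _ J' _ h => rowExp_injective h)]
  conv_rhs => rw [← p.support_sum_monomial_coeff]
  symm
  refine Finset.sum_subset (fun s hs => ?_) (fun s _ hs => ?_)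
  · obtain ⟨J, hJ⟩ := exists_rowExp_eq (hdeg s hs)
    exact Finset.mem_image.mpr ⟨J, Finset.mem_univ _, hJ⟩
  · rw [notMem_support_iff.mp hs, monomial_zero]

/-- **`ι ∘ Ξ = id` on form-symmetric polynomials of form degrees `(n,…,n)`** (characteristic zero).
[cite: Landsberg2017, Ex. 9.1.2.1] -/
theorem polarize_depolarize [CharZero k] {p : MvPolynomial (Fin d × Fin N) k}
    (hsymm : ∀ π : Equiv.Perm (Fin d), rename (fun li : Fin d × Fin N => (π li.1, li.2)) p = p)
    (hdeg : ∀ a ∈ p.support, ∀ kk : Fin d, ∑ i : Fin N, a (kk, i) = n) :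
    polarize N n d (depolarize N n d p) = p := by
  rw [polarize_eq_sum_monomial (isHomogeneous_depolarize p)]
  simp_rw [arrOf_depolarize hsymm, div_mul_cancel₀ _ (factorial_mul_rowMultCoef_ne_zero (k := k) _)]
  exact sum_monomial_rowExp_coeff hdeg

/-- **A2.3 — `polarize` maps the forms of degree `d` ONTO the form-symmetric polynomials of form
degrees `(n,…,n)`** (characteristic zero; the preimage is `depolarize p`).
[cite: Landsberg2017, Ex. 9.1.2.1] -/
theorem exists_polarize_eq [CharZero k] (p : MvPolynomial (Fin d × Fin N) k)
    (hsymm : ∀ π : Equiv.Perm (Fin d), rename (fun li : Fin d × Fin N => (π li.1, li.2)) p = p)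
    (hdeg : ∀ a ∈ p.support, ∀ kk : Fin d, ∑ i : Fin N, a (kk, i) = n) :
    ∃ F : MvPolynomial (DegIdx (Fin N) n) k, F.IsHomogeneous d ∧ polarize N n d F = p :=
  ⟨depolarize N n d p, isHomogeneous_depolarize p, polarize_depolarize hsymm hdeg⟩

/-- **The image of `polarize` on forms of degree `d` is form-symmetric** (the array of a form is
symmetric). [cite: Landsberg2017, Ex. 9.1.2.1] -/
theorem rename_rowPerm_polarize [CharZero k] {F : MvPolynomial (DegIdx (Fin N) n) k}
    (hF : F.IsHomogeneous d) (π : Equiv.Perm (Fin d)) :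
    rename (fun li : Fin d × Fin N => (π li.1, li.2)) (polarize N n d F) = polarize N n d F := by
  rw [polarize_eq_sum_monomial hF, map_sum]
  simp_rw [rename_monomial, mapDomain_rowPerm_rowExp]
  refine (Fintype.sum_equiv (Equiv.arrowCongr π.symm (Equiv.refl (DegIdx (Fin N) n))) _ _
    fun J => ?_).symm
  have hJ : (Equiv.arrowCongr π.symm (Equiv.refl (DegIdx (Fin N) n))) J = J ∘ ⇑π := by
    funext r
    simp [Equiv.arrowCongr_apply]
  have hJJ : (J ∘ ⇑π) ∘ ⇑π.symm = J := by
    funext r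
    simp
  rw [hJ, hJJ, rowMultCoef_comp_perm, arrOf_comp_perm]

/-- **The image of `polarize` on forms of degree `d` has form degrees `(n,…,n)`**: every monomial of
`polarize F` is a `Y^{M_J}`. [cite: Landsberg2017, Ex. 9.1.2.1] -/
theorem rowDegree_polarize [CharZero k] {F : MvPolynomial (DegIdx (Fin N) n) k}
    (hF : F.IsHomogeneous d) {a : Fin d × Fin N →₀ ℕ} (ha : a ∈ (polarize N n d F).support)
    (kk : Fin d) : ∑ i : Fin N, a (kk, i) = n := by
  classical
  rw [polarize_eq_sum_monomial hF] at ha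
  obtain ⟨J, -, hJ⟩ := Finset.mem_biUnion.mp (support_sum ha)
  rw [support_monomial] at hJ
  split_ifs at hJ with h
  · exact absurd hJ (Finset.notMem_empty a)
  · rw [Finset.mem_singleton] at hJ
    rw [hJ]
    exact sum_rowExp_apply J kk

end Restitution

/-! ## §5 Highest-weight vectors (A2.4) -/

section HighestWeight

/-- **Semi-invariance transports along `polarize`**: for a highest-weight vector `F` of weight `χ`,
`formSubst g⁻¹ (polarize F) = χ(g) · polarize F` for upper-triangular `g` (A2.1).
[cite: Landsberg2017, §9.1.2 (equivariance)] -/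
theorem formSubst_polarize_of_mem_highestWeightSpace [CharZero k] (χ : Weight (Fin N))
    {F : MvPolynomial (DegIdx (Fin N) n) k} (hF : F ∈ highestWeightSpace (coordRep (Fin N) k n) χ)
    {g : GL (Fin N) k} (hg : IsUpperTriangular g) :
    formSubst N d ((g⁻¹ : GL (Fin N) k) : Matrix (Fin N) (Fin N) k) (polarize N n d F) =
      weightChar χ g • polarize N n d F := by
  rw [← polarize_coordRep, (mem_highestWeightSpace_iff _ _ _).1 hF g hg, map_smul]

/-- **A2.4 — `polarize` reflects highest-weight vectors** (forms of degree `d`, characteristic zero):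
if `formSubst g⁻¹ (polarize F) = χ(g) · polarize F` for all upper-triangular `g`, then `F` is a
highest-weight vector of weight `χ` for `coordRep` (equivariance A2.1 + injectivity A2.2 applied to
`g·F − χ(g) F`, a form of degree `d`). [cite: Landsberg2017, §9.1.2 (equivariance)] -/
theorem mem_highestWeightSpace_of_polarize [CharZero k] (χ : Weight (Fin N))
    {F : MvPolynomial (DegIdx (Fin N) n) k} (hF : F.IsHomogeneous d)
    (h : ∀ g : GL (Fin N) k, IsUpperTriangular g →
      formSubst N d ((g⁻¹ : GL (Fin N) k) : Matrix (Fin N) (Fin N) k) (polarize N n d F) =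
        weightChar χ g • polarize N n d F) :
    F ∈ highestWeightSpace (coordRep (Fin N) k n) χ := by
  rw [mem_highestWeightSpace_iff]
  intro g hg
  rw [coordRep_apply]
  refine polarize_injOn (isHomogeneous_coordSubst g hF)
    ((homogeneousSubmodule _ k d).smul_mem _ hF) ?_
  rw [← coordRep_apply, polarize_coordRep, h g hg, map_smul]

/-- **Highest-weight vectors correspond under `polarize`** (forms of degree `d`): `F ∈ HWV_χ` iff
`polarize F` is `B`-semi-invariant of weight `χ` under `formSubst g⁻¹`.
[cite: Landsberg2017, §9.1.2 (equivariance)] -/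
theorem mem_highestWeightSpace_iff_polarize [CharZero k] (χ : Weight (Fin N))
    {F : MvPolynomial (DegIdx (Fin N) n) k} (hF : F.IsHomogeneous d) :
    F ∈ highestWeightSpace (coordRep (Fin N) k n) χ ↔
      ∀ g : GL (Fin N) k, IsUpperTriangular g →
        formSubst N d ((g⁻¹ : GL (Fin N) k) : Matrix (Fin N) (Fin N) k) (polarize N n d F) =
          weightChar χ g • polarize N n d F :=
  ⟨fun h _ hg => formSubst_polarize_of_mem_highestWeightSpace χ h hg,
    mem_highestWeightSpace_of_polarize χ hF⟩

end HighestWeight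

end ChowReciprocity

end Literature.Computability.AlgebraicComplexity

end
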